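import Summits.Ventures.CertifiedManyBodySolver.Observables.PairLROGroundStateClassCover
import Literature.MathematicalPhysics.QuantumLattice.InfVolFermionStateGaugeAction
import Literature.MathematicalPhysics.QuantumLattice.ErgodicGroundStatePairLROCeiling
import HarnessLib

/-!
# OP1-C in IDENTITY FORM, part 3: the STATE-FREE sentences — a `μ`-cover of one-point cell nodes bounds the
# `d`-wave pair amplitude `|ω(P₀^d)|` of EVERY translation-invariant ground state of density `n`, and the box
# pair LRO of every ERGODIC one

HONEST FRAMING: soundness / bookkeeping theorems for a CEILING route at positivity scale; a ceiling never
speaks to the presence of pairing; not a superconductivity verdict; nothing in this file is a number. Crew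
hubbard-obs (D-0042), seat hubbard-obs-p1 (`prover-hubbard-obs-p1-g11-0`), PAIRCORR-SDP §19. Zero compute; no
definition; no named fact; no `sorry`.

What the identity-form reading (parts 1–2) delivers that the torus/tower route does not: the cell sentences speak
about infinite-volume translation-invariant GROUND STATES directly (Bratteli–Kishimoto–Robinson minimisers of
`H^{tt'} − μN`), so a cover of the certified chemical-potential bracket yields sentences with NO torus sequence in them:

* §1 `re_expect_localPairAt_le_of_groundStateClass_cells'` — for every `μ ∈ [μ₋(n), μ₊(n)]` and every
  translation-invariant minimiser `ω` of `H^{tt'} − μN` of density `n`: `Re ω(P₀^d) ≤ B` (`B ≥ M_j` for all cells).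
* §2 `norm_expect_localPairAt_le_of_groundStateClass_cells` — the MODULUS: `|ω(P₀^d)| ≤ B` (the class is invariant
  under the global `U(1)` gauge action, `IsMeanEnergyMinimiser.gaugeShift`, and `(ω∘γ_θ)(P₀) = e^{−2iθ} ω(P₀)`; rotate the
  amplitude to the positive real axis). This is a ceiling on the `d`-wave pair amplitude of EVERY translation-invariant
  infinite-volume ground state at the anchor density — the quasi-average order parameter restricted to density `n`.
* §3 `boxPairLRO_le_of_isErgodic_groundStateClass_cells` — for every ERGODIC such ground state the box-averaged pair
  correlation `N⁻⁴ Σ_{x,y∈[0,N)²} ω(P_x^d⋆ P_y^d)` converges to `|ω(P₀^d)|² ≤ B²` (`IsErgodic.tendsto_re_boxAverage_dWavePairCorr`):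
  the pair-LRO ceiling `B²` holds state by state on the ergodic ground states (non-ergodic ones are reached by the
  torus/tower reading of `PairLROTowerWitnessGroundState`).
* §0 `density_gaugeShift` (gauge transforms keep the density), `cover_of_grid` (a monotone grid is a cover).

References: T. Koma, H. Tasaki, J. Stat. Phys. 76 (1994) 745, §1, §2.4 [KomaTasaki1994]; O. Bratteli, A. Kishimoto,
D. W. Robinson, Commun. Math. Phys. 64 (1978) 41, Thm. 2 [BratteliKishimotoRobinson1978]; O. Bratteli, D. W. Robinson,
*OAQSM 1* (1987) Thm. 4.3.17 (ergodic states) [BratteliRobinsonI1987]; R. B. Griffiths, Phys. Rev. 152 (1966) 240, §II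
[Griffiths1966].
-/

noncomputable section

namespace Summit.Ventures.CertifiedManyBodySolver.Observables

open Matrix Complex Finset Literature.MathematicalPhysics.QuantumLattice Literature.Probability.LatticeModels
open Literature.MathematicalPhysics.QuantumLattice.HubbardWave0 ThermodynamicLimit Filter Topology
open Literature.MathematicalPhysics.QuantumManyBody.StateRelaxation
open scoped ComplexOrder ComplexConjugate BigOperators

/-! ### §0  Helpers -/

/-- **Gauge transforms keep the particle density** (`γ_θ` fixes `n_{0σ}`). [cite: BratteliRobinsonII1997, §5.2.2] -/
theorem density_gaugeShift {d : ℕ} (ω : InfVolFermionState d) (θ : ℝ) : (ω.gaugeShift θ).density = ω.density := by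
  simp only [InfVolFermionState.density, InfVolFermionState.densityAt, InfVolFermionState.gaugeShift_expect, map_add,
    gaugeAut_nAt]

/-- **A monotone grid of closed cells is a cover**: `m : Fin (J+2) → ℝ` monotone, cells `[m j, m (j+1)]` with grid points
`μg j` and half-widths `Δg j` (`μg j − Δg j ≤ m j`, `m (j+1) ≤ μg j + Δg j`): every `μ ∈ [m 0, m last]` is within `Δg j`
of some `μg j`. [folklore] -/
theorem cover_of_grid {J : ℕ} (m : Fin (J + 2) → ℝ) (hm : Monotone m) (μg Δg : Fin (J + 1) → ℝ)
    (hleft : ∀ j, μg j - Δg j ≤ m j.castSucc) (hright : ∀ j, m j.succ ≤ μg j + Δg j) :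
    ∀ μ ∈ Set.Icc (m 0) (m (Fin.last (J + 1))), ∃ j ∈ (Finset.univ : Finset (Fin (J + 1))), |μg j - μ| ≤ Δg j := by
  intro μ hμ
  obtain ⟨j, hj⟩ := exists_mem_Icc_castSucc_succ_of_monotone hm hμ
  refine ⟨j, Finset.mem_univ _, abs_le.2 ⟨?_, ?_⟩⟩
  · linarith [hj.2, hright j]
  · linarith [hj.1, hleft j]

/-! ### §1  The real part: every translation-invariant ground state of density `n` -/

section StateFree

/-- **STATE-FREE one-point ceiling, real part.** At an anchor `(U, n, t')` (`t = 1`, `U ≥ 0`, `0 ≤ n < 2`): a certified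
cap `e(n) ≤ u`, a certified bracket `[μlo, μhi] ⊇ [μ₋(n), μ₊(n)]`, cells covering the bracket with one-point CELL
SENTENCES `M j` on the ground-state class (as in `ObsPairLROCeilingAt_of_groundStateClass_cells`) and `M j ≤ B` give:
for every `μ ∈ [μ₋(n), μ₊(n)]` and every translation-invariant minimiser `ω` of `H^{tt'} − μN` of density `n`,
`Re ω(P₀^d) ≤ B`. [cite: BratteliKishimotoRobinson1978, Thm. 2 (p. 47)] [cite: KomaTasaki1994, §1] -/
theorem re_expect_localPairAt_le_of_groundStateClass_cells' {tp U n : ℝ} (hU : 0 ≤ U) (hn0 : 0 ≤ n) (hn2 : n < 2)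
    {u : ℝ} (hu : energyDensityTT' 1 tp U n ≤ u)
    {μlo μhi : ℝ} (hμlo : μlo ≤ chemPotMinusTT' 1 tp U n) (hμhi : chemPotPlusTT' 1 tp U n ≤ μhi)
    {J : Type*} (cells : Finset J) (μg Δg M : J → ℝ)
    (hcover : ∀ μ ∈ Set.Icc μlo μhi, ∃ j ∈ cells, |μg j - μ| ≤ Δg j)
    (hcell : ∀ j ∈ cells, ∀ μc : ℝ, |μg j - μc| ≤ Δg j → ∀ ω : InfVolFermionState 2,
      ω.IsMeanEnergyMinimiser (hubbardTTPrimeSourcedInteraction 1 tp U μc dWaveFormFactor 0) 1 →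
      ω.density = n → ω.meanEnergy (hubbardTTPrimeFermionInteraction 1 tp U) 1 ≤ u →
        (ω.expect (pairRegion (insert (0 : Site 2) unitSteps) 0)
          (localPairAt (insert (0 : Site 2) unitSteps) dWaveFormFactor 0)).re ≤ M j)
    {B : ℝ} (hB : ∀ j ∈ cells, M j ≤ B) {μ : ℝ}
    (hμ : μ ∈ Set.Icc (chemPotMinusTT' 1 tp U n) (chemPotPlusTT' 1 tp U n)) {ω : InfVolFermionState 2}
    (hmin : ω.IsMeanEnergyMinimiser (hubbardTTPrimeMuInteraction 1 tp U μ) 1) (hρ : ω.density = n) :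
    (ω.expect (pairRegion (insert (0 : Site 2) unitSteps) 0)
      (localPairAt (insert (0 : Site 2) unitSteps) dWaveFormFactor 0)).re ≤ B := by
  obtain ⟨j, hj, hjμ⟩ := hcover μ ⟨hμlo.trans hμ.1, hμ.2.trans hμhi⟩
  have he : ω.meanEnergy (hubbardTTPrimeFermionInteraction 1 tp U) 1 ≤ u :=
    (meanEnergy_le_energyDensityTT'_of_isMeanEnergyMinimiser_hubbardTTPrimeMu hU hn0 hn2 hmin hρ).trans hu
  have hmin' : ω.IsMeanEnergyMinimiser (hubbardTTPrimeSourcedInteraction 1 tp U μ dWaveFormFactor 0) 1 := by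
    rw [hubbardTTPrimeSourcedInteraction_zero_source]; exact hmin
  exact (hcell j hj μ hjμ ω hmin' hρ he).trans (hB j hj)

/-! ### §2  The modulus, by gauge rotation -/

/-- **STATE-FREE one-point ceiling, MODULUS: `|ω(P₀^d)| ≤ B` for every translation-invariant ground state of density
`n`** (same hypotheses as §1). The class of translation-invariant minimisers of the gauge-invariant pencil
`H^{tt'} − μN` of density `n` is invariant under the global `U(1)` gauge action `ω ↦ ω∘γ_θ`, under which
`ω(P₀^d) ↦ e^{−2iθ} ω(P₀^d)`; rotating the amplitude onto the positive real axis turns the real-part bound into a bound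
on the modulus. [cite: BratteliKishimotoRobinson1978, Thm. 2 (p. 47)] [cite: KomaTasaki1994, §2.4] -/
theorem norm_expect_localPairAt_le_of_groundStateClass_cells {tp U n : ℝ} (hU : 0 ≤ U) (hn0 : 0 ≤ n) (hn2 : n < 2)
    {u : ℝ} (hu : energyDensityTT' 1 tp U n ≤ u)
    {μlo μhi : ℝ} (hμlo : μlo ≤ chemPotMinusTT' 1 tp U n) (hμhi : chemPotPlusTT' 1 tp U n ≤ μhi)
    {J : Type*} (cells : Finset J) (μg Δg M : J → ℝ)
    (hcover : ∀ μ ∈ Set.Icc μlo μhi, ∃ j ∈ cells, |μg j - μ| ≤ Δg j)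
    (hcell : ∀ j ∈ cells, ∀ μc : ℝ, |μg j - μc| ≤ Δg j → ∀ ω : InfVolFermionState 2,
      ω.IsMeanEnergyMinimiser (hubbardTTPrimeSourcedInteraction 1 tp U μc dWaveFormFactor 0) 1 →
      ω.density = n → ω.meanEnergy (hubbardTTPrimeFermionInteraction 1 tp U) 1 ≤ u →
        (ω.expect (pairRegion (insert (0 : Site 2) unitSteps) 0)
          (localPairAt (insert (0 : Site 2) unitSteps) dWaveFormFactor 0)).re ≤ M j)
    {B : ℝ} (hB : ∀ j ∈ cells, M j ≤ B) {μ : ℝ}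
    (hμ : μ ∈ Set.Icc (chemPotMinusTT' 1 tp U n) (chemPotPlusTT' 1 tp U n)) {ω : InfVolFermionState 2}
    (hmin : ω.IsMeanEnergyMinimiser (hubbardTTPrimeMuInteraction 1 tp U μ) 1) (hρ : ω.density = n) :
    ‖ω.expect (pairRegion (insert (0 : Site 2) unitSteps) 0)
      (localPairAt (insert (0 : Site 2) unitSteps) dWaveFormFactor 0)‖ ≤ B := by
  set z : ℂ := ω.expect (pairRegion (insert (0 : Site 2) unitSteps) 0)
    (localPairAt (insert (0 : Site 2) unitSteps) dWaveFormFactor 0) with hz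
  -- rotate: `θ = arg z / 2`, `(ω∘γ_θ)(P₀) = e^{−i arg z} z = ‖z‖`
  set θ : ℝ := Complex.arg z / 2 with hθ
  have hminθ : (ω.gaugeShift θ).IsMeanEnergyMinimiser (hubbardTTPrimeMuInteraction 1 tp U μ) 1 :=
    hmin.gaugeShift (hubbardTTPrimeMuInteraction_isGaugeInvariant 1 tp U μ) θ
  have hρθ : (ω.gaugeShift θ).density = n := by rw [density_gaugeShift]; exact hρ
  have hre := re_expect_localPairAt_le_of_groundStateClass_cells' hU hn0 hn2 hu hμlo hμhi cells μg Δg M hcover hcell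
    hB hμ hminθ hρθ
  have hrot : (ω.gaugeShift θ).expect (pairRegion (insert (0 : Site 2) unitSteps) 0)
      (localPairAt (insert (0 : Site 2) unitSteps) dWaveFormFactor 0) = ((‖z‖ : ℝ) : ℂ) := by
    rw [InfVolFermionState.gaugeShift_expect_localPairAt, ← hz]
    have h1 : ((‖z‖ : ℝ) : ℂ) * Complex.exp ((Complex.arg z : ℂ) * I) = z := Complex.norm_mul_exp_arg_mul_I z
    have h2 : Complex.exp (-(2 * (I * (θ : ℂ)))) * Complex.exp ((Complex.arg z : ℂ) * I) = 1 := by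
      rw [← Complex.exp_add, hθ, Complex.ofReal_div]
      have : -(2 * (I * ((Complex.arg z : ℂ) / (2 : ℕ)))) + (Complex.arg z : ℂ) * I = 0 := by push_cast; ring
      rw [show ((2 : ℝ) : ℂ) = ((2 : ℕ) : ℂ) by norm_num, this, Complex.exp_zero]
    calc Complex.exp (-(2 * (I * (θ : ℂ)))) * z
        = Complex.exp (-(2 * (I * (θ : ℂ)))) * (((‖z‖ : ℝ) : ℂ) * Complex.exp ((Complex.arg z : ℂ) * I)) := by
          rw [h1]
      _ = ((‖z‖ : ℝ) : ℂ) * (Complex.exp (-(2 * (I * (θ : ℂ)))) * Complex.exp ((Complex.arg z : ℂ) * I)) := by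
          ring
      _ = ((‖z‖ : ℝ) : ℂ) := by rw [h2, mul_one]
  rw [hrot, Complex.ofReal_re] at hre
  exact hre

/-! ### §3  Ergodic ground states: the box pair LRO is `|ω(P₀^d)|² ≤ B²` -/

/-- **ERGODIC translation-invariant ground states of density `n` obey the pair-LRO ceiling `B²` state by state**:
under the hypotheses of §1, for every `μ ∈ [μ₋(n), μ₊(n)]` and every ERGODIC translation-invariant minimiser `ω` of
`H^{tt'} − μN` of density `n`, the box-averaged `d`-wave pair correlation `N⁻⁴ Σ_{x,y∈[0,N)²} ω(P_x^d⋆ P_y^d)` converges to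
`|ω(P₀^d)|² ≤ B²`; stated `ε`-eventually. [cite: BratteliRobinsonI1987, Thm. 4.3.17] [cite: KomaTasaki1994, §2.4] -/
theorem boxPairLRO_le_of_isErgodic_groundStateClass_cells {tp U n : ℝ} (hU : 0 ≤ U) (hn0 : 0 ≤ n) (hn2 : n < 2)
    {u : ℝ} (hu : energyDensityTT' 1 tp U n ≤ u)
    {μlo μhi : ℝ} (hμlo : μlo ≤ chemPotMinusTT' 1 tp U n) (hμhi : chemPotPlusTT' 1 tp U n ≤ μhi)
    {J : Type*} (cells : Finset J) (μg Δg M : J → ℝ)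
    (hcover : ∀ μ ∈ Set.Icc μlo μhi, ∃ j ∈ cells, |μg j - μ| ≤ Δg j)
    (hcell : ∀ j ∈ cells, ∀ μc : ℝ, |μg j - μc| ≤ Δg j → ∀ ω : InfVolFermionState 2,
      ω.IsMeanEnergyMinimiser (hubbardTTPrimeSourcedInteraction 1 tp U μc dWaveFormFactor 0) 1 →
      ω.density = n → ω.meanEnergy (hubbardTTPrimeFermionInteraction 1 tp U) 1 ≤ u →
        (ω.expect (pairRegion (insert (0 : Site 2) unitSteps) 0)
          (localPairAt (insert (0 : Site 2) unitSteps) dWaveFormFactor 0)).re ≤ M j)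
    {B : ℝ} (hB : ∀ j ∈ cells, M j ≤ B) {μ : ℝ}
    (hμ : μ ∈ Set.Icc (chemPotMinusTT' 1 tp U n) (chemPotPlusTT' 1 tp U n)) {ω : InfVolFermionState 2}
    (herg : ω.IsErgodic) (hmin : ω.IsMeanEnergyMinimiser (hubbardTTPrimeMuInteraction 1 tp U μ) 1)
    (hρ : ω.density = n) (ε : ℝ) (hε : 0 < ε) :
    ∀ᶠ N : ℕ in atTop,
      (((N : ℂ) ^ 4)⁻¹ * ∑ x ∈ halfOpenBox 2 N, ∑ y ∈ halfOpenBox 2 N, ω.dWavePairCorr x y).re ≤ B ^ 2 + ε := by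
  have hlim := herg.tendsto_re_boxAverage_dWavePairCorr
  have hnorm := norm_expect_localPairAt_le_of_groundStateClass_cells hU hn0 hn2 hu hμlo hμhi cells μg Δg M hcover
    hcell hB hμ hmin hρ
  have hsq : ‖ω.expect (pairRegion (insert (0 : Site 2) unitSteps) 0)
      (localPairAt (insert 0 unitSteps) dWaveFormFactor 0)‖ ^ 2 ≤ B ^ 2 :=
    pow_le_pow_left₀ (norm_nonneg _) hnorm 2
  have hev := (tendsto_order.1 hlim).2 _ (lt_of_le_of_lt hsq (lt_add_of_pos_right _ hε))
  filter_upwards [hev] with N hN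
  exact hN.le

end StateFree

end Summit.Ventures.CertifiedManyBodySolver.Observables

end
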